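import Literature.GroupTheory.CombinatorialGroupTheory.RandomSclFreeGroupProofs
import HarnessLib

/-!
# Random rigidity of scl (Calegari–Walker 2013): proofs, part 5 — the surface (fatgraph) bound

D. Calegari, A. Walker, *Random rigidity in the free group*, Geom. Topol. 17 (2013)
[CalegariWalker2013], §3: an admissible surface — concretely a fatgraph `Y` whose boundary is
`N'` copies of the cyclic word `v` — certifies `scl(v) ≤ −χ(Y)/2N'` (Lemmas 3.4, 3.5, 3.7); this
is how the upper bound of Theorem 4.1 is obtained in §4.3 ("taking `N'` strips labeled `v` and
cutting them into rectangles …").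

We package the letter-level form of this certificate, building on Culler's lemma
(`commutatorLength_le_of_pairing_perturbed` in `RandomSclFreeGroupProofs`):

* **`commutatorLength_pow_le_of_blockPairing`** — let `W = v^b` (the concatenation of `b ≥ 1`
  copies of the word `v` of length `n`), `π` a pairing of the letters of `W` with inverse letters
  (the edges), and `u` any labelling of the positions which is invariant under
  "go to the partner, then to the cyclically-next position inside the same copy of `v`" (so `u`
  is constant on the vertices of the fatgraph whose `b` boundary components each read `v`). Then
  `2·cl(v^b) + #labels ≤ b n / 2 + b`.
* **`stableCommutatorLength_le_of_blockPairing`** — hence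
  `scl(v) ≤ (b n/2 + b − #labels) / (2b)`: with `E = bn/2` letter-edges and `V = #labels`
  letter-vertices, `−χ = E − V` and `scl(v) ≤ −χ/(2b) + 1/2` (Lemma 3.4 up to the additive `1/2`,
  which is immaterial at the scale `n / log n`).
-/

noncomputable section

namespace Literature.GroupTheory.CombinatorialGroupTheory

section SurfaceBound

open Equiv

/-- `|v^b| = b |v|` for the concatenation of `b` copies. [folklore] -/
theorem length_flatten_replicate {β : Type*} (v : List β) (b : ℕ) :
    (List.replicate b v).flatten.length = b * v.length := by
  induction b with
  | zero => simp
  | succ b ih => simp [List.replicate_succ, ih, Nat.succ_mul, Nat.add_comm]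

/-- `mk (v^b as a list) = (mk v)^b`. [folklore] -/
theorem mk_flatten_replicate {α : Type*} (v : List (α × Bool)) (b : ℕ) :
    FreeGroup.mk (List.replicate b v).flatten = FreeGroup.mk v ^ b := by
  induction b with
  | zero => simp [FreeGroup.one_eq_mk]
  | succ b ih => rw [List.replicate_succ, List.flatten_cons, ← FreeGroup.mul_mk, ih, pow_succ']

/-- The cyclic successor inside blocks of length `n`: `j ↦ j + 1`, except that the last position
of a block goes back to its first position. It stays below `b n`. [folklore] -/
theorem blockSucc_lt {n N j : ℕ} (hN : n ∣ N) (hj : j < N) :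
    (if n ∣ j + 1 then j + 1 - n else j + 1) < N := by
  split_ifs with h
  · rcases n with _ | n
    · rw [Nat.zero_dvd] at h
      omega
    · omega
  · have hne : j + 1 ≠ N := fun e => h (e ▸ hN)
    omega

/-- **The fatgraph certificate, letter level (after Culler, CW Lemma 3.5/3.7).** Let `W` be the
concatenation of `b ≥ 1` copies of a word `v`, `π` a pairing of the positions of `W` matching
inverse letters, and `u` a labelling of the positions with
`u (blockSucc (π i)) = u i` for all `i`, where `blockSucc` is the cyclic successor inside each copy
of `v`. Then `2 · cl((mk v)^b) + #(labels used) ≤ b·|v| / 2 + b`.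
[cite: CalegariWalker2013, Lemma 3.5 and Lemma 3.4] -/
theorem commutatorLength_pow_le_of_blockPairing {α γ : Type*} [DecidableEq α] [DecidableEq γ]
    (v : List (α × Bool)) (b : ℕ) (hb : 1 ≤ b)
    (π : Equiv.Perm (Fin (List.replicate b v).flatten.length))
    (hπ : IsPairing (List.replicate b v).flatten π)
    (u : Fin (List.replicate b v).flatten.length → γ)
    (hu : ∀ i, u ⟨if v.length ∣ (π i : ℕ) + 1 then (π i : ℕ) + 1 - v.length else (π i : ℕ) + 1,
      blockSucc_lt ((length_flatten_replicate v b).symm ▸ dvd_mul_left v.length b) (π i).isLt⟩ =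
        u i) :
    2 * commutatorLength (FreeGroup.mk v ^ b) + (Finset.univ.image u).card ≤
      b * v.length / 2 + b := by
  classical
  have hN : (List.replicate b v).flatten.length = b * v.length := length_flatten_replicate v b
  rw [← mk_flatten_replicate, ← hN]
  -- the empty word
  rcases Nat.eq_zero_or_pos v.length with hn0 | hnpos
  · have hN0 : (List.replicate b v).flatten.length = 0 := by rw [hN, hn0, mul_zero]
    have hWnil : (List.replicate b v).flatten = [] := List.length_eq_zero_iff.mp hN0
    have hcl : commutatorLength (FreeGroup.mk (List.replicate b v).flatten) = 0 := by
      rw [hWnil, ← FreeGroup.one_eq_mk, commutatorLength_one]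
    have hV : (Finset.univ.image u).card = 0 := by
      apply Nat.eq_zero_of_le_zero
      calc (Finset.univ.image u).card
          ≤ (Finset.univ : Finset (Fin (List.replicate b v).flatten.length)).card :=
            Finset.card_image_le
        _ = 0 := by rw [Finset.card_univ, Fintype.card_fin, hN0]
    rw [hcl, hV]
    omega
  -- one block: the block successor is `finRotate`
  rcases Nat.lt_or_ge b 2 with hb1 | hb2
  · have hb1 : b = 1 := by omega
    subst hb1
    have hN1 : (List.replicate 1 v).flatten.length = v.length := by rw [hN, one_mul]
    have hvert : ∀ i, u (finRotate _ (π i)) = u i := by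
      intro i
      rw [← hu i]
      congr 1
      apply Fin.ext
      rw [val_finRotate (by omega)]
      simp only
      have hlt := (π i).isLt
      split_ifs with h
      · -- `π i` is the last position
        obtain ⟨c, hc⟩ := h
        have hc1 : c = 1 := by
          rcases c with _ | c
          · omega
          · rcases c with _ | c
            · rfl
            · nlinarith
        subst hc1
        rw [mul_one] at hc
        rw [hc, ← hN1, Nat.mod_self, hN1]
        omega
      · have hne : (π i : ℕ) + 1 ≠ v.length := fun e => h ⟨1, by rw [mul_one]; exact e⟩
        rw [Nat.mod_eq_of_lt (by omega)]
    have h := commutatorLength_le_of_pairing _ π hπ.1 hπ.2.1 hπ.2.2 u hvert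
    omega
  -- `b ≥ 2`: the block-start cycle `ρ`
  have hNpos : 0 < (List.replicate b v).flatten.length := by
    rw [hN]; exact Nat.mul_pos (by omega) hnpos
  let f : Fin b ≃ {x : Fin (List.replicate b v).flatten.length // v.length ∣ (x : ℕ)} :=
    { toFun := fun t => ⟨⟨(t : ℕ) * v.length, by
          rw [hN]; exact Nat.mul_lt_mul_of_lt_of_le t.isLt le_rfl hnpos⟩,
        dvd_mul_left v.length t⟩
      invFun := fun x => ⟨(x.1 : ℕ) / v.length, by
        rw [Nat.div_lt_iff_lt_mul hnpos]; have h1 := x.1.isLt; have h2 := hN; omega⟩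
      left_inv := fun t => by
        apply Fin.ext
        simp only
        exact Nat.mul_div_cancel _ hnpos
      right_inv := fun x => by
        apply Subtype.ext
        apply Fin.ext
        simp only
        exact Nat.div_mul_cancel x.2 }
  have hf_val : ∀ t : Fin b,
      ((f t : {x : Fin (List.replicate b v).flatten.length // v.length ∣ (x : ℕ)}) :
        Fin (List.replicate b v).flatten.length).val = (t : ℕ) * v.length := fun t => rfl
  have hfsymm_val : ∀ x : {x : Fin (List.replicate b v).flatten.length // v.length ∣ (x : ℕ)},
      ((f.symm x : Fin b) : ℕ) = (x.1 : ℕ) / v.length := fun x => rfl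
  set ρ : Equiv.Perm (Fin (List.replicate b v).flatten.length) := (finRotate b).extendDomain f
    with hρ
  have hρsupp : ρ.support.card = b := by
    rw [hρ, Equiv.Perm.card_support_extend_domain, support_finRotate_of_le hb2, Finset.card_univ,
      Fintype.card_fin]
  have hρ1 : ρ ≠ 1 := by
    intro h1
    have : ρ.support.card = 0 := by rw [h1, Equiv.Perm.support_one, Finset.card_empty]
    omega
  -- `(finRotate b)⁻¹` on values
  have hrot : ∀ s : Fin b, (((finRotate b).symm s : Fin b) : ℕ) = ((s : ℕ) + (b - 1)) % b := by
    intro s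
    have hs := s.isLt
    have e : (finRotate b).symm s = ⟨((s : ℕ) + (b - 1)) % b, Nat.mod_lt _ (by omega)⟩ := by
      rw [Equiv.symm_apply_eq]
      apply Fin.ext
      rw [val_finRotate (by omega)]
      simp only
      by_cases hs0 : (s : ℕ) = 0
      · rw [hs0, zero_add, Nat.mod_eq_of_lt (by omega : b - 1 < b), show b - 1 + 1 = b by omega,
          Nat.mod_self]
      · rw [show (s : ℕ) + (b - 1) = (s - 1) + b by omega, Nat.add_mod_right,
          Nat.mod_eq_of_lt (by omega : (s : ℕ) - 1 < b), show (s : ℕ) - 1 + 1 = s by omega,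
          Nat.mod_eq_of_lt hs]
    rw [e]
  -- `ρ⁻¹ ∘ finRotate` is the block successor
  have hsucc : ∀ j : Fin (List.replicate b v).flatten.length, ρ.symm (finRotate _ j) =
      ⟨if v.length ∣ (j : ℕ) + 1 then (j : ℕ) + 1 - v.length else (j : ℕ) + 1,
        blockSucc_lt (hN.symm ▸ dvd_mul_left v.length b) j.isLt⟩ := by
    intro j
    have hjlt := j.isLt
    rw [hρ, Equiv.Perm.extendDomain_symm]
    have hyval : ((finRotate _ j : Fin (List.replicate b v).flatten.length) : ℕ) =
        ((j : ℕ) + 1) % (List.replicate b v).flatten.length := val_finRotate hNpos j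
    by_cases hdvd : v.length ∣ (j : ℕ) + 1
    · -- `j + 1` is a block boundary
      have hydvd : v.length ∣ ((finRotate _ j : Fin (List.replicate b v).flatten.length) : ℕ) := by
        rw [hyval]
        exact (Nat.dvd_mod_iff (hN.symm ▸ dvd_mul_left v.length b)).mpr hdvd
      rw [Equiv.Perm.extendDomain_apply_subtype (finRotate b).symm f hydvd]
      apply Fin.ext
      rw [hf_val, hrot, hfsymm_val]
      simp only [if_pos hdvd]
      rw [hyval]
      obtain ⟨c, hc⟩ := hdvd
      have hc1 : 1 ≤ c := by
        rcases c with _ | c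
        · omega
        · omega
      have hcb : c ≤ b := by
        have : v.length * c ≤ v.length * b := by rw [← hc, mul_comm, ← hN]; omega
        exact Nat.le_of_mul_le_mul_left this hnpos
      rcases Nat.lt_or_ge c b with hcb' | hcb'
      · -- interior block boundary
        have hlt : (j : ℕ) + 1 < (List.replicate b v).flatten.length := by
          have h1 : v.length * c + v.length ≤ b * v.length := by
            rw [mul_comm b, ← Nat.mul_succ]
            exact Nat.mul_le_mul_left _ hcb'
          have h2 := hN
          omega
        rw [Nat.mod_eq_of_lt hlt, hc, Nat.mul_div_cancel_left c hnpos,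
          show c + (b - 1) = (c - 1) + b by omega, Nat.add_mod_right,
          Nat.mod_eq_of_lt (by omega : c - 1 < b), Nat.sub_mul, one_mul, Nat.mul_comm]
      · -- the very last position wraps to the start of the last block
        have hcb'' : c = b := le_antisymm hcb hcb'
        subst hcb''
        have hjN : (j : ℕ) + 1 = (List.replicate c v).flatten.length := by
          have h1 := Nat.mul_comm v.length c
          have h2 := hN
          omega
        rw [hjN, Nat.mod_self, Nat.zero_div, zero_add, Nat.mod_eq_of_lt (by omega), hN,
          Nat.sub_mul, one_mul]
    · -- not a block boundary: `ρ` fixes `j + 1`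
      have hlt : (j : ℕ) + 1 < (List.replicate b v).flatten.length := by
        have hne : (j : ℕ) + 1 ≠ (List.replicate b v).flatten.length := fun e =>
          hdvd (by rw [e, hN]; exact dvd_mul_left _ _)
        omega
      have hyval' : ((finRotate _ j : Fin (List.replicate b v).flatten.length) : ℕ) = (j : ℕ) + 1 := by
        rw [hyval, Nat.mod_eq_of_lt hlt]
      have hyndvd : ¬ v.length ∣ ((finRotate _ j : Fin (List.replicate b v).flatten.length) : ℕ) := by
        rw [hyval']; exact hdvd
      rw [Equiv.Perm.extendDomain_apply_not_subtype (finRotate b).symm f hyndvd]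
      apply Fin.ext
      simp only [if_neg hdvd]
      exact hyval'
  have hu' : ∀ i, u (ρ.symm (finRotate _ (π i))) = u i := by
    intro i
    rw [hsucc (π i)]
    exact hu i
  have h := commutatorLength_le_of_pairing_perturbed _ π hπ.1 hπ.2.1 hπ.2.2 ρ hρ1 u hu'
  rw [hρsupp] at h
  exact h

/-- **The surface bound for scl, letter level (CW Lemma 3.4 + Lemma 3.5).** In the situation of
`commutatorLength_pow_le_of_blockPairing` (a fatgraph with `b` boundary components each reading
`v`, `E = b|v|/2` letter-edges and `V = #labels` letter-vertices),
`scl(v) ≤ (b|v|/2 + b − V)/(2b) = (E − V)/(2b) + 1/2`. [cite: CalegariWalker2013, Lemma 3.4] -/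
theorem stableCommutatorLength_le_of_blockPairing {α γ : Type*} [DecidableEq α] [DecidableEq γ]
    (v : List (α × Bool)) (b : ℕ) (hb : 1 ≤ b)
    (π : Equiv.Perm (Fin (List.replicate b v).flatten.length))
    (hπ : IsPairing (List.replicate b v).flatten π)
    (u : Fin (List.replicate b v).flatten.length → γ)
    (hu : ∀ i, u ⟨if v.length ∣ (π i : ℕ) + 1 then (π i : ℕ) + 1 - v.length else (π i : ℕ) + 1,
      blockSucc_lt ((length_flatten_replicate v b).symm ▸ dvd_mul_left v.length b) (π i).isLt⟩ =
        u i) :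
    stableCommutatorLength (FreeGroup.mk v) ≤
      (((b * v.length / 2 + b : ℕ) : ℝ) - (Finset.univ.image u).card) / (2 * b) := by
  have h := commutatorLength_pow_le_of_blockPairing v b hb π hπ u hu
  have hscl := stableCommutatorLength_le_div (FreeGroup.mk v) (n := b) (by omega)
  refine hscl.trans ?_
  have hb' : (0 : ℝ) < b := by exact_mod_cast (show 0 < b by omega)
  rw [div_le_div_iff₀ hb' (by positivity)]
  have h' : (2 * (commutatorLength (FreeGroup.mk v ^ b) : ℝ)) + (Finset.univ.image u).card ≤
      ((b * v.length / 2 + b : ℕ) : ℝ) := by exact_mod_cast h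
  nlinarith

end SurfaceBound

end Literature.GroupTheory.CombinatorialGroupTheory

end
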